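import Summits.QuantumFields.YangMills.Theorems.BalabanUVNodesN19CoreProductBlocks

/-!
# BalabanUVNodes ∕ N19 (NE7) — THE PRODUCT (EXTENSIVITY) CALCULUS OF THE HYBRID NE7 DATUM, II: A FINITE FAMILY OF INDEPENDENT
# BLOCKS (index `Π b : β, κ b`, classes `Fintype.piFinset`) — `Core`: constants `Σ_b c_b`, radius `Σ_b vol_b·δ_b`; `RelWeightBound`:
# `1 − ∏_b (1 − W_b) ≤ Σ_b W_b`; `ShellWeightBound`: `Σ_b Wsh_b`; `HybridNE7` modulo the displayed joint smallness — AND THE SHARPNESS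
# OF THE RADIUS (`card β` two-state blocks of spread `δ` are matched at per-volume radius `δ` and at NO smaller one)

Cell `pub-ymgap` (HUMAN RULING D-0062 Track A; D-0149 width push, director-ym №197), seat `pub-ymgap-dag-n19-w2` (WIDTH SEAT 2 of 3 on
NODE n19 = NE7) gen 2.  Filed `--kind proof --supports stmt-QuantumFields-20544 --as helper` (K3⁷ `SpineGivenEndpointR13SepCoPH`);
COUNT-NEUTRAL.  File I = `…N19CoreProductBlocks` (two blocks `ι₁ × ι₂`; imported for `core_of_core_one` and the framing).

WHAT IS TYPED.  For a finite block set `β` and per-block hybrid data on indices `κ b`: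
* §0 bookkeeping: the union bound `1 − ∏_b (1 − x_b) ≤ Σ_b x_b` (`0 ≤ x_b ≤ 1`), the good tuples `piFinset (T ∖ Bad)`, and the bad-tuple
  mass `Σ_{bad} ∏ f = ∏_b Σ_{T_b} f_b − ∏_b Σ_{T_b ∖ Bad_b} f_b` (`Finset.prod_univ_sum`);
* §2 `core_pi` (constants `Σ_b c_b`, radius `Σ_b vol_b·δ_b`, `T4HybridMatching.prod_sandwich` BY NAME at each good tuple) and ★
  `core_pi_const`: `card β` blocks of EQUAL volume `v` at a COMMON per-volume radius `δ` = ONE datum of volume `card β · v` at the SAME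
  `δ` — the letter `vol` of `Spine.NE7.Core` ∕ `HybridNE7` IS this block count; `relWeightBound_pi` (bad weight `1 − ∏_b (1 − W_b)`,
  `< 1` and summable INHERITED through §0's union bound — no smallness hypothesis); `shellWeightBound_pi` (product shell
  `∏ A_b − ∏ (A_b − shA_b)`, weight `Σ_b Wsh_b`, by the union bound when `Σ_b Wsh_b < 1` and trivially otherwise); `hybridNE7_pi`
  (joint smallness `(1 − ∏(1 − W_b)) + Σ_b Wsh_b < 1` DISPLAYED — the one clause that does not compose, as in file I); and the weight
  remainder is extensive: `−log(∏_b (1 − W_b)) = Σ_b (−log(1 − W_b))`, so the shell-free `hybridDelta` of the product is the volume-weighted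
  sum of the blocks' (`neg_log_one_sub_piWeight`, `hybridDelta_pi`);
* §3 SHARPNESS: the two-state family (`κ b = Bool`, run A ≡ 1, run B `e^{±δ_K}`, no bad class) is matched with constant `0` at volume
  `card β` and per-volume radius `δ` (`core_twoState`), and any matching at volume `card β` with per-volume radius `r` has `δ_K ≤ r_K`
  (`le_of_core_twoState`: test the all-`true` and all-`false` tuples at `t = 0`), whence `not_core_twoState_of_lt` — the radius
  `Σ_b δ_b` of §2 is ATTAINED; `vol·δ` cannot be improved to `o(vol)·δ` on product data.
[folklore] order arithmetic on finite sums and products (Mathlib `Fintype.piFinset`, `Finset.prod_univ_sum`, `Finset.prod_le_prod`,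
`Finset.prod_le_one`, `Finset.prod_pos`, `Real.exp_nat_mul`; in-tree `T4HybridMatching.prod_sandwich`); nothing of Bałaban's instantiated.

HONEST FRAMING.  Count-neutral kernel bookkeeping; ZERO estimate content about Bałaban's objects (no carrier of record is a product
datum; [Balaban1988Convergent] (2.18)'s history weights do NOT factor over blocks exactly — the polymer coupling is where NE7's content
lives; the exact-independence case is the zeroth-order skeleton every `Core` producer must reproduce, cf. [Balaban1989LargeFieldI] p.175
∕ [King1986] (3.10)–(3.13) as quoted in `T4HybridMatching`).  NE7 ∕ NE7b ∕ NE7c NOT PRINTED for d = 4 and NOT proved; N19 NOT discharged;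
K3⁷ OPEN, not claimed; counts UNMOVED (typed 28∕28 · discharged 5∕27 (A 5∕28)); no count claim.  One finite 𝕋⁴ programme at fixed ε,
Bałaban AS PRINTED; the YM mass gap (Clay) is NOT proved by any of this — R4 closes the conditional finite-𝕋⁴ rung `BalabanLadder.UV`
only; nothing continuum ∕ ℝ⁴ ∕ OS.  No `def`, no `instance`, no `sorry`.
-/

noncomputable section

namespace Summit.QuantumFields.YangMills.BalabanUVNodes.N19CoreProductBlockFamily

open Literature.MathematicalPhysics.QuantumFieldTheory.Balaban1983to89
open T4HybridMatching T4WeightBudget T4IndicatorShell T4MatchingAssembly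
open Summit.QuantumFields.BalabanUV.T4Continuum.Spine
open Summit.QuantumFields.YangMills.BalabanUVNodes.N19CoreProductBlocks (core_of_core_one)
open scoped BigOperators

/-! ## §0 Finite-product bookkeeping on tuples -/

section AuxPi

variable {β : Type*} [Fintype β] [DecidableEq β]

omit [Fintype β] in
/-- `1 − ∏_{b ∈ s} (1 − x_b) ≤ Σ_{b ∈ s} x_b` for `0 ≤ x_b ≤ 1` (union bound; induction on `s`). [folklore] -/
theorem one_sub_prod_one_sub_le_sum (s : Finset β) {x : β → ℝ} (h0 : ∀ b ∈ s, 0 ≤ x b) (h1 : ∀ b ∈ s, x b ≤ 1) :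
    1 - ∏ b ∈ s, (1 - x b) ≤ ∑ b ∈ s, x b := by
  induction s using Finset.induction_on with
  | empty => simp
  | insert a s ha ih =>
    rw [Finset.prod_insert ha, Finset.sum_insert ha]
    have hs0 : ∀ b ∈ s, 0 ≤ x b := fun b hb => h0 b (Finset.mem_insert_of_mem hb)
    have hs1 : ∀ b ∈ s, x b ≤ 1 := fun b hb => h1 b (Finset.mem_insert_of_mem hb)
    have hP0 : 0 ≤ ∏ b ∈ s, (1 - x b) := Finset.prod_nonneg fun b hb => sub_nonneg.2 (hs1 b hb)
    have hP1 : ∏ b ∈ s, (1 - x b) ≤ 1 :=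
      Finset.prod_le_one (fun b hb => sub_nonneg.2 (hs1 b hb)) fun b hb => sub_le_self _ (hs0 b hb)
    have ha0 := h0 a (Finset.mem_insert_self a s)
    have := ih hs0 hs1
    nlinarith

/-- the GOOD tuples: `(piFinset T).filter (¬ ∃ b, τ b ∈ Bad b) = piFinset (fun b => T b ∖ Bad b)`. [folklore] -/
theorem filter_not_exists_mem_piFinset {κ : β → Type*} [∀ b, DecidableEq (κ b)] (T Bad : (b : β) → Finset (κ b)) :
    (Fintype.piFinset T).filter (fun τ => ¬ ∃ b, τ b ∈ Bad b) = Fintype.piFinset fun b => T b \ Bad b := by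
  ext τ
  simp only [Finset.mem_filter, Fintype.mem_piFinset, Finset.mem_sdiff, not_exists]
  exact ⟨fun h b => ⟨h.1 b, h.2 b⟩, fun h => ⟨fun b => (h b).1, fun b => (h b).2⟩⟩

/-- a tuple is GOOD iff every component is good. [folklore] -/
theorem mem_good_pi_iff {κ : β → Type*} [∀ b, DecidableEq (κ b)] {T Bad : (b : β) → Finset (κ b)} {τ : (b : β) → κ b} :
    τ ∈ Fintype.piFinset T \ (Fintype.piFinset T).filter (fun τ => ∃ b, τ b ∈ Bad b) ↔ ∀ b, τ b ∈ T b \ Bad b := by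
  simp only [Finset.mem_sdiff, Finset.mem_filter, Fintype.mem_piFinset, not_and, not_exists]
  exact ⟨fun h b => ⟨h.1 b, h.2 h.1 b⟩, fun h => ⟨fun b => (h b).1, fun _ b => (h b).2⟩⟩

/-- `Σ_{bad tuples} ∏ f = ∏_b Σ_{T b} f_b − ∏_b Σ_{T b ∖ Bad b} f_b` (`Finset.prod_univ_sum` twice + the good-tuple identity). [folklore] -/
theorem sum_bad_pi_eq {κ : β → Type*} [∀ b, DecidableEq (κ b)] (T Bad : (b : β) → Finset (κ b)) (f : (b : β) → κ b → ℝ) :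
    ∑ τ ∈ (Fintype.piFinset T).filter (fun τ => ∃ b, τ b ∈ Bad b), ∏ b, f b (τ b) =
      (∏ b, ∑ x ∈ T b, f b x) - ∏ b, ∑ x ∈ T b \ Bad b, f b x := by
  rw [Finset.prod_univ_sum, Finset.prod_univ_sum, ← filter_not_exists_mem_piFinset T Bad, eq_sub_iff_add_eq,
    Finset.sum_filter_add_sum_filter_not]

end AuxPi

/-! ## §2 A FINITE FAMILY OF INDEPENDENT BLOCKS (index `Π b : β, κ b`, classes `Fintype.piFinset`) -/

section Pi

variable {β : Type*} [Fintype β] [DecidableEq β] {κ : β → Type*} [∀ b, DecidableEq (κ b)] {l₀ : ℝ} {vol : β → ℝ}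
  {T : (b : β) → ℕ → Finset (κ b)} {Bad : (b : β) → ℕ → ℝ → Finset (κ b)}
  {P Q A B shA shB : (b : β) → ℕ → ℝ → κ b → ℝ} {δ W Wsh : β → ℕ → ℝ}

/-- **`Core` OVER A FINITE BLOCK FAMILY**: per-block cores `Core l₀ (vol b) (T b) (Bad b) (P b) (Q b) (δ b)` with run A's good cores
nonnegative give the core of the product datum (classes = tuples `piFinset`, weights = `∏_b`, a tuple bad iff SOME component is bad) with
constants `Σ_b c_b` and radius `Σ_b vol_b·δ_b` (at `vol := 1`) — `T4HybridMatching.prod_sandwich` BY NAME at each good tuple. [folklore] -/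
theorem core_pi (h : ∀ b, NE7.Core l₀ (vol b) (T b) (Bad b) (P b) (Q b) (δ b))
    (hP : ∀ b K t, |t| ≤ l₀ → ∀ x ∈ T b K \ Bad b K t, 0 ≤ P b K t x) :
    NE7.Core l₀ 1 (fun K => Fintype.piFinset fun b => T b K)
      (fun K t => (Fintype.piFinset fun b => T b K).filter fun τ => ∃ b, τ b ∈ Bad b K t)
      (fun K t τ => ∏ b, P b K t (τ b)) (fun K t τ => ∏ b, Q b K t (τ b)) (fun K => ∑ b, vol b * δ b K) := by
  intro K
  choose c hc using fun b => h b K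
  refine ⟨∑ b, c b, fun t ht τ hτ => ?_⟩
  have hgood : ∀ b, τ b ∈ T b K \ Bad b K t := mem_good_pi_iff.1 hτ
  have hsw := prod_sandwich Finset.univ (φ := fun b => P b K t (τ b)) (ψ := fun b => Q b K t (τ b)) (c := c)
    (r := fun b => vol b * δ b K) (fun b _ => hP b K t ht (τ b) (hgood b)) (fun b _ => (hc b t ht (τ b) (hgood b)).1)
    fun b _ => (hc b t ht (τ b) (hgood b)).2
  simpa only [one_mul] using hsw

/-- **EXTENSIVITY**: `card β` independent blocks of EQUAL volume `v` at a COMMON per-volume radius `δ` compose into ONE datum of volume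
`card β · v` at the SAME per-volume radius `δ` — the letter `vol` of `Spine.NE7.Core` ∕ `HybridNE7` IS this count. [folklore] -/
theorem core_pi_const {v : ℝ} {δ : ℕ → ℝ} (h : ∀ b, NE7.Core l₀ v (T b) (Bad b) (P b) (Q b) δ)
    (hP : ∀ b K t, |t| ≤ l₀ → ∀ x ∈ T b K \ Bad b K t, 0 ≤ P b K t x) :
    NE7.Core l₀ (Fintype.card β * v) (fun K => Fintype.piFinset fun b => T b K)
      (fun K t => (Fintype.piFinset fun b => T b K).filter fun τ => ∃ b, τ b ∈ Bad b K t)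
      (fun K t τ => ∏ b, P b K t (τ b)) (fun K t τ => ∏ b, Q b K t (τ b)) δ :=
  core_of_core_one (by simpa only [Finset.sum_const, Finset.card_univ, nsmul_eq_mul, mul_assoc] using core_pi h hP)

/-- **`RelWeightBound` (NE7b) OVER A FINITE BLOCK FAMILY** with bad weight `1 − ∏_b (1 − W_b)`: nonnegative, `< 1`, and summable because
`1 − ∏_b (1 − W_b) ≤ Σ_b W_b` — NO smallness hypothesis; term weights nonnegative on the classes (interface I-2). [folklore] -/
theorem relWeightBound_pi (h : ∀ b, RelWeightBound l₀ (T b) (A b) (B b) (Bad b) (W b))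
    (hA : ∀ b K t, |t| ≤ l₀ → ∀ x ∈ T b K, 0 ≤ A b K t x) (hB : ∀ b K t, |t| ≤ l₀ → ∀ x ∈ T b K, 0 ≤ B b K t x) :
    RelWeightBound l₀ (fun K => Fintype.piFinset fun b => T b K) (fun K t τ => ∏ b, A b K t (τ b)) (fun K t τ => ∏ b, B b K t (τ b))
      (fun K t => (Fintype.piFinset fun b => T b K).filter fun τ => ∃ b, τ b ∈ Bad b K t) (fun K => 1 - ∏ b, (1 - W b K)) := by
  have key : ∀ (K : ℕ) (t : ℝ), |t| ≤ l₀ → ∀ F : (b : β) → κ b → ℝ, (∀ b, ∀ x ∈ T b K, 0 ≤ F b x) →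
      (∀ b, ∑ x ∈ Bad b K t, F b x ≤ W b K * ∑ x ∈ T b K, F b x) →
      ∑ τ ∈ (Fintype.piFinset fun b => T b K).filter (fun τ => ∃ b, τ b ∈ Bad b K t), ∏ b, F b (τ b) ≤
        (1 - ∏ b, (1 - W b K)) * ∑ τ ∈ Fintype.piFinset (fun b => T b K), ∏ b, F b (τ b) := by
    intro K t ht F hF hb
    rw [sum_bad_pi_eq, ← Finset.prod_univ_sum]
    have hS : ∀ b, 0 ≤ ∑ x ∈ T b K, F b x := fun b => Finset.sum_nonneg (hF b)
    have hG : ∀ b, (1 - W b K) * ∑ x ∈ T b K, F b x ≤ ∑ x ∈ T b K \ Bad b K t, F b x := fun b => by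
      have := Finset.sum_sdiff (f := F b) ((h b).bad_subset K t ht)
      rw [one_sub_mul]
      linarith [hb b]
    have hprod : ∏ b, (1 - W b K) * ∑ x ∈ T b K, F b x ≤ ∏ b, ∑ x ∈ T b K \ Bad b K t, F b x :=
      Finset.prod_le_prod (fun b _ => mul_nonneg (sub_pos.2 ((h b).lt_one K)).le (hS b)) fun b _ => hG b
    rw [Finset.prod_mul_distrib] at hprod
    rw [one_sub_mul]
    linarith
  exact
  { bad_subset := fun K t _ => Finset.filter_subset _ _
    nonneg := fun K => sub_nonneg.2 (Finset.prod_le_one (fun b _ => (sub_pos.2 ((h b).lt_one K)).le) fun b _ => sub_le_self _ ((h b).nonneg K))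
    lt_one := fun K => sub_lt_self 1 (Finset.prod_pos fun b _ => sub_pos.2 ((h b).lt_one K))
    summable := (summable_sum fun b _ => (h b).summable).of_nonneg_of_le
      (fun K => sub_nonneg.2 (Finset.prod_le_one (fun b _ => (sub_pos.2 ((h b).lt_one K)).le) fun b _ => sub_le_self _ ((h b).nonneg K)))
      fun K => one_sub_prod_one_sub_le_sum Finset.univ (fun b _ => (h b).nonneg K) fun b _ => ((h b).lt_one K).le
    bad_left := fun K t ht => key K t ht (fun b => A b K t) (fun b => hA b K t ht) fun b => (h b).bad_left K t ht
    bad_right := fun K t ht => key K t ht (fun b => B b K t) (fun b => hB b K t ht) fun b => (h b).bad_right K t ht }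

omit [∀ b, DecidableEq (κ b)] in
/-- **`ShellWeightBound` (NE7c) OVER A FINITE BLOCK FAMILY** with the product shell `∏_b A_b − ∏_b (A_b − shA_b)` (so that the product CORE
is the product of the cores) and shell weight `Σ_b Wsh_b` — by the union bound `1 − ∏(1 − Wsh_b) ≤ Σ Wsh_b` when `Σ_b Wsh_b < 1`, trivially
otherwise. [folklore] -/
theorem shellWeightBound_pi (h : ∀ b, ShellWeightBound l₀ (T b) (A b) (B b) (shA b) (shB b) (Wsh b)) :
    ShellWeightBound l₀ (fun K => Fintype.piFinset fun b => T b K) (fun K t τ => ∏ b, A b K t (τ b)) (fun K t τ => ∏ b, B b K t (τ b))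
      (fun K t τ => ∏ b, A b K t (τ b) - ∏ b, (A b K t (τ b) - shA b K t (τ b)))
      (fun K t τ => ∏ b, B b K t (τ b) - ∏ b, (B b K t (τ b) - shB b K t (τ b))) (fun K => ∑ b, Wsh b K) := by
  classical
  -- termwise: `0 ≤ ∏ F − ∏ (F − f) ≤ ∏ F` for `0 ≤ f_b ≤ F_b`
  have term : ∀ (F f : β → ℝ), (∀ b, 0 ≤ f b) → (∀ b, f b ≤ F b) →
      0 ≤ ∏ b, F b - ∏ b, (F b - f b) ∧ ∏ b, F b - ∏ b, (F b - f b) ≤ ∏ b, F b := by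
    intro F f hf hfF
    have h1 : ∏ b, (F b - f b) ≤ ∏ b, F b :=
      Finset.prod_le_prod (fun b _ => sub_nonneg.2 (hfF b)) fun b _ => sub_le_self _ (hf b)
    have h2 : 0 ≤ ∏ b, (F b - f b) := Finset.prod_nonneg fun b _ => sub_nonneg.2 (hfF b)
    exact ⟨sub_nonneg.2 h1, sub_le_self _ h2⟩
  -- the total, with the `Σ Wsh < 1` ∕ `≥ 1` split
  have tot : ∀ (K : ℕ) (t : ℝ), |t| ≤ l₀ → ∀ F f : (b : β) → κ b → ℝ, (∀ b, ∀ x ∈ T b K, 0 ≤ f b x) → (∀ b, ∀ x ∈ T b K, f b x ≤ F b x) →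
      (∀ b, ∑ x ∈ T b K, f b x ≤ Wsh b K * ∑ x ∈ T b K, F b x) →
      ∑ τ ∈ Fintype.piFinset (fun b => T b K), (∏ b, F b (τ b) - ∏ b, (F b (τ b) - f b (τ b))) ≤
        (∑ b, Wsh b K) * ∑ τ ∈ Fintype.piFinset (fun b => T b K), ∏ b, F b (τ b) := by
    intro K t ht F f hf hfF hw
    rw [Finset.sum_sub_distrib, ← Finset.prod_univ_sum, ← Finset.prod_univ_sum (f := fun b x => F b x - f b x)]
    simp only [Finset.sum_sub_distrib]
    have hS : ∀ b, 0 ≤ ∑ x ∈ T b K, F b x := fun b => Finset.sum_nonneg fun x hx => (hf b x hx).trans (hfF b x hx)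
    have hC : ∀ b, 0 ≤ ∑ x ∈ T b K, F b x - ∑ x ∈ T b K, f b x := fun b => by
      rw [← Finset.sum_sub_distrib]; exact Finset.sum_nonneg fun x hx => sub_nonneg.2 (hfF b x hx)
    have hPS : 0 ≤ ∏ b, ∑ x ∈ T b K, F b x := Finset.prod_nonneg fun b _ => hS b
    have hPC : 0 ≤ ∏ b, (∑ x ∈ T b K, F b x - ∑ x ∈ T b K, f b x) := Finset.prod_nonneg fun b _ => hC b
    have hw0 : ∀ b, 0 ≤ Wsh b K := fun b => (h b).nonneg K
    by_cases hsum : ∑ b, Wsh b K < 1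
    · have hwb : ∀ b, Wsh b K ≤ 1 := fun b =>
        ((Finset.single_le_sum (fun b _ => hw0 b) (Finset.mem_univ b)).trans hsum.le)
      have hCb : ∀ b, (1 - Wsh b K) * ∑ x ∈ T b K, F b x ≤ ∑ x ∈ T b K, F b x - ∑ x ∈ T b K, f b x := fun b => by
        rw [one_sub_mul]; linarith [hw b]
      have hprod : ∏ b, (1 - Wsh b K) * ∑ x ∈ T b K, F b x ≤ ∏ b, (∑ x ∈ T b K, F b x - ∑ x ∈ T b K, f b x) :=
        Finset.prod_le_prod (fun b _ => mul_nonneg (sub_nonneg.2 (hwb b)) (hS b)) fun b _ => hCb b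
      rw [Finset.prod_mul_distrib] at hprod
      have hub := mul_le_mul_of_nonneg_right
        (sub_le_comm.1 (one_sub_prod_one_sub_le_sum Finset.univ (fun b _ => hw0 b) fun b _ => hwb b)) hPS
      rw [one_sub_mul] at hub
      linarith
    · rw [not_lt] at hsum
      have : ∏ b, ∑ x ∈ T b K, F b x ≤ (∑ b, Wsh b K) * ∏ b, ∑ x ∈ T b K, F b x :=
        le_mul_of_one_le_left hPS hsum
      linarith
  exact
  { nonneg := fun K => Finset.sum_nonneg fun b _ => (h b).nonneg K
    summable := summable_sum fun b _ => (h b).summable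
    sh_nonneg_left := fun K t ht τ hτ => (term (fun b => A b K t (τ b)) (fun b => shA b K t (τ b))
      (fun b => (h b).sh_nonneg_left K t ht (τ b) (Fintype.mem_piFinset.1 hτ b)) fun b => (h b).sh_le_left K t ht (τ b) (Fintype.mem_piFinset.1 hτ b)).1
    sh_le_left := fun K t ht τ hτ => (term (fun b => A b K t (τ b)) (fun b => shA b K t (τ b))
      (fun b => (h b).sh_nonneg_left K t ht (τ b) (Fintype.mem_piFinset.1 hτ b)) fun b => (h b).sh_le_left K t ht (τ b) (Fintype.mem_piFinset.1 hτ b)).2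
    sh_nonneg_right := fun K t ht τ hτ => (term (fun b => B b K t (τ b)) (fun b => shB b K t (τ b))
      (fun b => (h b).sh_nonneg_right K t ht (τ b) (Fintype.mem_piFinset.1 hτ b)) fun b => (h b).sh_le_right K t ht (τ b) (Fintype.mem_piFinset.1 hτ b)).1
    sh_le_right := fun K t ht τ hτ => (term (fun b => B b K t (τ b)) (fun b => shB b K t (τ b))
      (fun b => (h b).sh_nonneg_right K t ht (τ b) (Fintype.mem_piFinset.1 hτ b)) fun b => (h b).sh_le_right K t ht (τ b) (Fintype.mem_piFinset.1 hτ b)).2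
    left := fun K t ht => tot K t ht (fun b => A b K t) (fun b => shA b K t) (fun b => (h b).sh_nonneg_left K t ht)
      (fun b => (h b).sh_le_left K t ht) fun b => (h b).left K t ht
    right := fun K t ht => tot K t ht (fun b => B b K t) (fun b => shB b K t) (fun b => (h b).sh_nonneg_right K t ht)
      (fun b => (h b).sh_le_right K t ht) fun b => (h b).right K t ht }

/-- **`HybridNE7` OVER A FINITE BLOCK FAMILY modulo the DISPLAYED joint smallness** `(1 − ∏_b (1 − W_b)) + Σ_b Wsh_b < 1`. [folklore] -/
theorem hybridNE7_pi (h : ∀ b, HybridNE7 l₀ (vol b) (T b) (A b) (B b) (Bad b) (W b) (shA b) (shB b) (Wsh b) (δ b))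
    (hlt : ∀ K, (1 - ∏ b, (1 - W b K)) + ∑ b, Wsh b K < 1) :
    HybridNE7 l₀ 1 (fun K => Fintype.piFinset fun b => T b K) (fun K t τ => ∏ b, A b K t (τ b)) (fun K t τ => ∏ b, B b K t (τ b))
      (fun K t => (Fintype.piFinset fun b => T b K).filter fun τ => ∃ b, τ b ∈ Bad b K t) (fun K => 1 - ∏ b, (1 - W b K))
      (fun K t τ => ∏ b, A b K t (τ b) - ∏ b, (A b K t (τ b) - shA b K t (τ b)))
      (fun K t τ => ∏ b, B b K t (τ b) - ∏ b, (B b K t (τ b) - shB b K t (τ b)))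
      (fun K => ∑ b, Wsh b K) (fun K => ∑ b, vol b * δ b K) where
  weight := relWeightBound_pi (fun b => (h b).weight)
    (fun b K t ht x hx => ((h b).shell.sh_nonneg_left K t ht x hx).trans ((h b).shell.sh_le_left K t ht x hx))
    fun b K t ht x hx => ((h b).shell.sh_nonneg_right K t ht x hx).trans ((h b).shell.sh_le_right K t ht x hx)
  shell := shellWeightBound_pi fun b => (h b).shell
  lt_one := hlt
  summable := summable_sum fun b _ => ((h b).summable.mul_left (vol b))
  core := by
    have hc := core_pi (fun b => NE7.core_of_hybridNE7 (h b))
      (fun b K t ht x hx => sub_nonneg.2 ((h b).shell.sh_le_left K t ht x (Finset.mem_sdiff.1 hx).1))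
    intro K
    obtain ⟨c, hc⟩ := hc K
    refine ⟨c, fun t ht τ hτ => ?_⟩
    simpa only [sub_sub_cancel] using hc t ht τ hτ

omit [DecidableEq β] in
/-- **THE WEIGHT REMAINDER IS EXTENSIVE OVER THE BLOCK FAMILY**: with the product bad weight `1 − ∏_b (1 − W_b)`,
`−log(1 − (1 − ∏_b (1 − W_b))) = Σ_b (−log(1 − W_b))` (`W_b < 1`; `Real.log_prod`). [folklore] -/
theorem neg_log_one_sub_piWeight {w : β → ℝ} (h : ∀ b, w b < 1) :
    -Real.log (1 - (1 - ∏ b, (1 - w b))) = ∑ b, -Real.log (1 - w b) := by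
  rw [sub_sub_cancel, Real.log_prod (s := Finset.univ) (f := fun b => 1 - w b) (fun b _ => (sub_pos.2 (h b)).ne'), ← Finset.sum_neg_distrib]

omit [DecidableEq β] in
/-- … hence the shell-free HYBRID REMAINDER of the product datum is the volume-weighted SUM of the blocks' hybrid remainders:
`hybridDelta 1 (Σ_b vol_b·δ_b) (1 − ∏_b (1 − W_b)) K = Σ_b vol_b · hybridDelta vol_b δ_b W_b K` (`vol_b ≠ 0`, `W_b K < 1`). [folklore] -/
theorem hybridDelta_pi (hv : ∀ b, vol b ≠ 0) {K : ℕ} (h : ∀ b, W b K < 1) :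
    hybridDelta 1 (fun K => ∑ b, vol b * δ b K) (fun K => 1 - ∏ b, (1 - W b K)) K = ∑ b, vol b * hybridDelta (vol b) (δ b) (W b) K := by
  have e : ∑ b, vol b * hybridDelta (vol b) (δ b) (W b) K = ∑ b, (vol b * δ b K + -Real.log (1 - W b K)) :=
    Finset.sum_congr rfl fun b _ => by rw [mul_hybridDelta (hv b), sub_eq_add_neg]
  rw [e, Finset.sum_add_distrib, ← neg_log_one_sub_piWeight (w := fun b => W b K) h, ← one_mul (hybridDelta 1 _ _ K),
    mul_hybridDelta one_ne_zero, one_mul, sub_eq_add_neg]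

end Pi

/-! ## §3 SHARPNESS: the radius `Σ_b δ_b` of §2 is ATTAINED — `card β` two-state blocks of spread `δ` -/

section TwoState

variable {β : Type*} [Fintype β] [DecidableEq β] {l₀ : ℝ} {δ r : ℕ → ℝ}

/-- THE TWO-STATE BLOCK FAMILY, positive side: `card β` independent blocks, each with the two states `true ∕ false`, run A's weight `1`,
run B's weight `e^{+δ_K}` on `true` and `e^{−δ_K}` on `false`, no bad class; with `0 ≤ δ_K` the product datum (weights `1` and
`∏_b e^{±δ_K}`) is matched with constant `0` at volume `card β` and per-volume radius `δ` (each block alone: volume `1`, radius `δ`). [folklore] -/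
theorem core_twoState (hδ : ∀ K, 0 ≤ δ K) :
    NE7.Core l₀ (Fintype.card β) (fun _ => Fintype.piFinset fun _ : β => (Finset.univ : Finset Bool)) (fun _ _ => ∅)
      (fun _ _ _ => 1) (fun K _ τ => ∏ b, if τ b then Real.exp (δ K) else Real.exp (-δ K)) δ := by
  intro K
  refine ⟨0, fun t _ τ _ => ?_⟩
  have hlo : ∀ b ∈ (Finset.univ : Finset β), Real.exp (-δ K) ≤ (if τ b then Real.exp (δ K) else Real.exp (-δ K)) := fun b _ => by
    split_ifs
    · exact Real.exp_le_exp.2 (by linarith [hδ K])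
    · exact le_rfl
  have hhi : ∀ b ∈ (Finset.univ : Finset β), (if τ b then Real.exp (δ K) else Real.exp (-δ K)) ≤ Real.exp (δ K) := fun b _ => by
    split_ifs
    · exact le_rfl
    · exact Real.exp_le_exp.2 (by linarith [hδ K])
  have h1 := Finset.prod_le_prod (fun b _ => (Real.exp_pos _).le) hlo
  have h2 := Finset.prod_le_prod (fun b _ => by positivity) hhi
  rw [Finset.prod_const, Finset.card_univ, ← Real.exp_nat_mul] at h1 h2
  constructor
  · simpa only [zero_sub, mul_one, mul_neg, neg_mul] using h1
  · simpa only [zero_add, mul_one] using h2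

/-- **SHARPNESS**: if the two-state block family is matched with SOME constant at volume `card β` and per-volume radius `r`, then `δ_K ≤ r_K`
for every `K` (test the all-`true` and the all-`false` tuple at `t = 0`: `card·δ ≤ c + card·r` and `c − card·r ≤ −card·δ`).  So §2's radius
`Σ_b δ_b` (`= card β · δ` here) cannot be improved on product data: the letter `vol` in `vol·δ` is NOT an artefact of the bookkeeping.
(`Nonempty β`, `0 ≤ l₀` so that `t = 0` is a source value.) [folklore] -/
theorem le_of_core_twoState [Nonempty β] (hl₀ : 0 ≤ l₀)
    (h : NE7.Core l₀ (Fintype.card β) (fun _ => Fintype.piFinset fun _ : β => (Finset.univ : Finset Bool)) (fun _ _ => ∅)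
      (fun _ _ _ => 1) (fun K _ τ => ∏ b, if τ b then Real.exp (δ K) else Real.exp (-δ K)) r) (K : ℕ) :
    δ K ≤ r K := by
  obtain ⟨c, hc⟩ := h K
  have hmem : ∀ τ : β → Bool, τ ∈ (Fintype.piFinset fun _ : β => (Finset.univ : Finset Bool)) \ ∅ := fun τ => by
    simp only [Finset.sdiff_empty, Fintype.mem_piFinset, Finset.mem_univ, implies_true]
  have ht0 : |(0 : ℝ)| ≤ l₀ := by simpa using hl₀
  have hT := (hc 0 ht0 (fun _ => true) (hmem _)).2
  have hF := (hc 0 ht0 (fun _ => false) (hmem _)).1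
  simp only [if_true, Bool.false_eq_true, if_false, Finset.prod_const, Finset.card_univ, mul_one] at hT hF
  rw [← Real.exp_nat_mul, Real.exp_le_exp] at hT hF
  have hn : (0 : ℝ) < Fintype.card β := Nat.cast_pos.2 Fintype.card_pos
  nlinarith

/-- … contrapositive: at any per-volume radius `r` with `r_K < δ_K` for some `K` the two-state family at volume `card β` is matched by NO
constant — `not Core`. [folklore] -/
theorem not_core_twoState_of_lt [Nonempty β] (hl₀ : 0 ≤ l₀) {K : ℕ} (hK : r K < δ K) :
    ¬ NE7.Core l₀ (Fintype.card β) (fun _ => Fintype.piFinset fun _ : β => (Finset.univ : Finset Bool)) (fun _ _ => ∅)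
      (fun _ _ _ => 1) (fun K _ τ => ∏ b, if τ b then Real.exp (δ K) else Real.exp (-δ K)) r :=
  fun h => not_lt.2 (le_of_core_twoState hl₀ h K) hK

end TwoState

end Summit.QuantumFields.YangMills.BalabanUVNodes.N19CoreProductBlockFamily

end
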